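import Summits.AtomisticToContinuum.HydrodynamicLimit.Theorems.LambertianContactSwapLambertianEulerKineticHeartOfInputs
import Summits.AtomisticToContinuum.HydrodynamicLimit.Theorems.LambertianContactSwapLambertianEulerCollisionalHeartOfInputs
import Summits.AtomisticToContinuum.HydrodynamicLimit.Theorems.LambertianContactSwapLambertianEulerInBandOfHearts
import HarnessLib

/-!
# Scratch (crux-strategist s2, stmt-11854): the generated glue ITEM of the split closes by the landed one-liner

Simulates the route file AFTER the split: the four children (bodies byte-identical to `children.json`) and the glue item
`LambertianEulerOfInputs : Prop := WindowLDLambda → GaussianVelocityTailsLambda → CollisionActivityTailsLambda →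
DiluteSelfConsistency → LambertianEuler` are added to the ROUTE namespace (open-ended), then closed by the composition that
`Theorems/LambertianContactSwapLambertianEulerSplit.lean` lands as `lambertianEuler_of_subs` (inlined here so that this scratch
does not depend on the proposal having landed): default heartbeats, the only unfolding is the route-style `def`s (delta) and
`DiluteSelfConsistency` (verbatim stmt-3091) against `ImplosionDichotomy.DiluteSelfConsistency` (same body).
-/

namespace Summit.AtomisticToContinuum.HydrodynamicLimit.Theses.LambertianContactSwap

open scoped BigOperators Topology Manifold Classical MeasureTheory ProbabilityTheory Matrix InnerProductSpace ComplexConjugate ContinuousMap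
open Filter Set Function TopologicalSpace MeasureTheory

/-- child 1 (crux): window large deviations under local-Gibbs restart = KCW-Λ ∧ CCW-Λ (by name). -/
def WindowLDLambda : Prop :=
  Summit.AtomisticToContinuum.HydrodynamicLimit.Theorems.LambertianContactSwapLambertianEulerKineticInputs.KineticClampedWindowLDLambda ∧ Summit.AtomisticToContinuum.HydrodynamicLimit.Theorems.LambertianContactSwapLambertianEulerCollisionalInputs.CollisionalClampedWindowLDLambda

/-- child 2 (crux): Gaussian velocity tails along Λ under the true law = TL1G-Λ (by name). -/
def GaussianVelocityTailsLambda : Prop :=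
  Summit.AtomisticToContinuum.HydrodynamicLimit.Theorems.LambertianContactSwapLambertianEulerKineticInputs.GaussianVelocityTailsLambda

/-- child 3 (crux): collision-activity tails along Λ under the true law = CAT-Λ (by name). -/
def CollisionActivityTailsLambda : Prop :=
  Summit.AtomisticToContinuum.HydrodynamicLimit.Theorems.LambertianContactSwapLambertianEulerCollisionalInputs.CollisionActivityTailsLambda

/-- child 4 (support, residual): dilute self-consistency, VERBATIM stmt-AtomisticToContinuum-3091. -/
def DiluteSelfConsistency : Prop :=
  ∀ η : ℝ, 0 < η → ∀ (a₀ θ₀ : Literature.MathematicalPhysics.KineticTheory.T3 → ℝ) (u₀ : Literature.MathematicalPhysics.KineticTheory.T3 → Literature.MathematicalPhysics.KineticTheory.V3), Continuous a₀ → Continuous θ₀ → Continuous u₀ → (∀ x, 0 < a₀ x) → (∀ x, 0 < θ₀ x) → ∃ σ₀ : ℝ, 0 < σ₀ ∧ ∀ σ : ℝ, 0 < σ → σ < σ₀ → ∀ (T : ℝ) (ρ θ : ℝ → Literature.MathematicalPhysics.KineticTheory.T3 → ℝ) (u : ℝ → Literature.MathematicalPhysics.KineticTheory.T3 → Literature.MathematicalPhysics.KineticTheory.V3),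 Literature.MathematicalPhysics.KineticTheory.IsHardSphereEulerSolution σ T ρ u θ → ∀ Φ : (N : ℕ) → Literature.Analysis.FluidPDE.HardSphereFlow (Literature.Analysis.FluidPDE.Torus.geometry (Fin 3)) (Literature.MathematicalPhysics.KineticTheory.hsDiameter σ N) (N + 1), Literature.MathematicalPhysics.KineticTheory.TendstoHydroFieldsAt (fun N => Literature.MathematicalPhysics.KineticTheory.localGibbsLaw σ a₀ u₀ θ₀ N (Φ N)) Φ ρ u θ 0 → ∀ t ∈ Set.Ico 0 T, ∀ x, ρ t x * σ ^ 3 < η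

/-- the glue item the gate generates for `--split LambertianEuler --into children.json --glue … --glue-decl-name LambertianEulerOfInputs`. -/
def LambertianEulerOfInputs : Prop :=
  WindowLDLambda → GaussianVelocityTailsLambda → CollisionActivityTailsLambda → DiluteSelfConsistency → LambertianEuler

/-- the residual child IS stmt-3091 (same body). -/
theorem diluteSelfConsistency_iff :
    DiluteSelfConsistency ↔ Summit.AtomisticToContinuum.HydrodynamicLimit.Theses.ImplosionDichotomy.DiluteSelfConsistency :=
  Iff.rfl

/-- **closing the glue item** by the landed pieces (= `…LambertianEulerSplit.lambertianEuler_of_subs` inlined). -/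
theorem lambertianEulerOfInputs_holds : LambertianEulerOfInputs :=
  fun hW hT hA hD =>
    Summit.AtomisticToContinuum.HydrodynamicLimit.Theorems.LambertianContactSwapLambertianEulerInBandOfHearts.lambertianEuler_of_inBand
      (Summit.AtomisticToContinuum.HydrodynamicLimit.Theorems.LambertianContactSwapLambertianEulerInBandOfHearts.lambertianEulerInBand_of_hearts
        (Summit.AtomisticToContinuum.HydrodynamicLimit.Theorems.LambertianContactSwapLambertianEulerKineticHeartOfInputs.kineticOneBlockInMeanLambdaLog_of_inputs
          hW.1 hT)
        (Summit.AtomisticToContinuum.HydrodynamicLimit.Theorems.LambertianContactSwapLambertianEulerCollisionalHeartOfInputs.collisionalOneBlockInMeanLambdaLog_of_inputs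
          hW.2 hA hT))
      hD

/-- costume probes (must all be genuine pieces): no child is the parent by `Iff.rfl`/`exact` — recorded as the ABSENCE of such
lemmas here; the positive direction parent → child 2/3 is FALSE in general (the inputs quantify over untied reference-started
dynamics / carry their own bands), so no `inBand_of_parent`-style lemma is attempted. -/
example : True := trivial

end Summit.AtomisticToContinuum.HydrodynamicLimit.Theses.LambertianContactSwap
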